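import Literature.AlgebraicGeometry.HodgeTheory.VHSDataHodgeLocusNowhereDense
import Literature.AlgebraicGeometry.HodgeTheory.VHSDataHodgeLocusInteriorChartHolomorphicLift
import HarnessLib

/-!
# The Hodge locus of bounded norm over a connected base of any dimension is everything or nowhere dense — the interior charts given by
# HOLOMORPHIC LIFTS of the period map (the metric comparison derived from the continuity of the Hodge metric on `D`)

Topic `Literature/AlgebraicGeometry/HodgeTheory` (namespace `Literature.AlgebraicGeometry.Motives.VHSData`), the sequel of
`HodgeTheory/VHSDataHodgeLocusNowhereDense.lean` (CDK §1 over a base of any dimension ASSUMING a uniform comparison `κ` of Hodge norms on each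
chart) and of `HodgeTheory/VHSDataHodgeLocusInteriorChartHolomorphicLift.lean` (the comparison DERIVED on a one-dimensional chart from a
holomorphic lift `F^• = g·F₀^•`, `g → 1` weakly, via `Motives/HodgeStructureHodgeMetricContinuity`).  THEOREMS ONLY (no definition, no named
fact, no instance; D-0026 net debt `0`).

PRINTED SOURCES, VERBATIM.  E. Cattani, P. Deligne, A. Kaplan, *On the locus of Hodge classes*, J. AMS 8 (1995), §1 (pp. 483–484): «`S` can be
covered by open subsets `U` with the following property: … the locus `T ⊂ U` where `h` remains of type `(p, p)`, i.e., in `ℱ^p`, is a complex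
analytic subspace of `U`» and «locally on `S`, `S^{(K)}` is a finite disjoint sum of closed analytic subspaces»; E. Cattani, A. Kaplan, W. Schmid
(LNM 1246, 1987), §3 proof of Cor. (3.7) (p. 22): «`S(C_{e·φ̃}·, ·̄) ∼ S(C_{F̂₀}·, ·̄)` on the required region».

THE HOLOMORPHIC-LIFT CHART in any dimension: `ψ : OpenPartialHomeomorph S E` (`E` a complex normed space, e.g. `ℂ^d`), `x ∈ ψ.source`; for
`c ∈ ψ.target`: `e c : V_{ψ⁻¹(c)} ≃ V` carrying every `F^q_{ψ⁻¹(c)}` to `g(c)·F₀^q`, `Q` to `Q₀ = P₀.form`, `V_ℤ` ONTO the finitely generated `Λ`;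
`g(c)`, `h(c)` mutually inverse endomorphisms of `V_ℂ`, the matrix coefficients of `h` holomorphic on the target, `g(c) → 1` weakly as `c → ψ(x)`.
* §1 `eventually_hodgeNorm_fiber_mem_Icc_of_lift_filter` — the continuity of the Hodge metric along the family in FILTER form (any parameter
  type, any filter along which `g → 1` weakly): eventually `(1 − ε)‖1 ⊗ e_c x‖₀ ≤ ‖1 ⊗ x‖_{ρ(c)} ≤ (1 + ε)‖1 ⊗ e_c x‖₀`.
* §2 `exists_mem_nhds_subset_or_interior_eq_empty_of_lift` — at `x`: a neighbourhood inside `hodgeLocusOfNormLe D p K`, or the locus has empty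
  interior on a neighbourhood (shrink to a coordinate ball with `κ = 1/2`, then `VHSDataHodgeLocusNowhereDense` §3);
  `compl_hodgeLocusOfNormLe_mem_nhds_of_lift` — outside the locus a whole neighbourhood is outside.
* §3 **`hodgeLocusOfNormLe_eq_univ_or_isNowhereDense_of_lift`** — **for `D : VHSData S k` on a preconnected `S` covered by holomorphic-lift
  charts, `hodgeLocusOfNormLe D p K` is CLOSED and either ALL of `S` or NOWHERE DENSE.**

## References

* [CattaniDeligneKaplan1995] E. Cattani, P. Deligne, A. Kaplan, *On the locus of Hodge classes*, J. Amer. Math. Soc. 8 (1995) 483–506: §1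
  (pp. 483–484).
* [CattaniKaplanSchmid1987] E. Cattani, A. Kaplan, W. Schmid, *Variations of polarized Hodge structure: asymptotics and monodromy*, LNM 1246
  (1987): §3, proof of Cor. (3.7) (p. 22).
* [VoisinHodgeII2003] C. Voisin, *Hodge Theory and Complex Algebraic Geometry II* (2003), §5.3.1 Lemma 5.13.
* [Schmid1973] W. Schmid, *Variation of Hodge structure: the singularities of the period mapping*, Invent. Math. 22 (1973), §3 (cite only).
-/

noncomputable section

open scoped TensorProduct ComplexOrder
open _root_.Topology _root_.Filter Set

namespace Literature.AlgebraicGeometry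

open Module
open Motives Motives.MixedHodgeStructure Motives.HodgeStructure
open Motives.HodgeStructure (conj ofRat ofRat_apply conj_ofRat)
open HodgeTheory

universe u

/-- For mutually inverse endomorphisms `g`, `h` of a module and a submodule `F`: `h⁻¹(F) = g(F)`. [folklore] -/
private theorem comap_eq_map_of_inverse' {R M : Type*} [CommSemiring R] [AddCommMonoid M] [Module R M] (F : Submodule R M)
    {g h : M →ₗ[R] M} (hgh : ∀ w, g (h w) = w) (hhg : ∀ w, h (g w) = w) : F.comap h = F.map g := by
  ext y
  rw [Submodule.mem_comap, Submodule.mem_map]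
  constructor
  · intro hy
    exact ⟨h y, hy, hgh y⟩
  · rintro ⟨x, hx, rfl⟩
    rwa [hhg]

namespace Motives.VHSData

variable {S : Type} [TopologicalSpace S] {k : ℤ} (D : VHSData S k)
variable {V : Type u} [AddCommGroup V] [Module ℚ V] [FiniteDimensional ℚ V]

/-! ## §1 Continuity of the Hodge metric along the family, filter form -/

/-- **The fibres' Hodge norms are uniformly quasi-isometric to the reference norm, eventually along any filter `l` on the chart along which
`g → 1` weakly.**  Chart modelled on any type `X`: `ρ : X → S`, `U ⊆ X` with `∀ᶠ c in l, c ∈ U`; for `c ∈ U`, `e c : V_{ρ(c)} ≃ V` carrying every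
`F^q_{ρ(c)}` to `g(c)·F₀^q` and `Q` to `Q₀`.  Then for `ε > 0`: **eventually along `l`, `(1 − ε)‖1 ⊗ e_c x‖₀ ≤ ‖1 ⊗ x‖_{ρ(c)} ≤ (1 + ε)‖1 ⊗ e_c x‖₀`**
for all `x` («`S(C_{e·φ̃}·, ·̄) ∼ S(C_{F̂₀}·, ·̄)`»). [cite: CattaniKaplanSchmid1987, §3 proof of Cor. (3.7) (p. 22)] [cite: CattaniDeligneKaplan1995, 2.1 (p. 486)] -/
theorem eventually_hodgeNorm_fiber_mem_Icc_of_lift_filter {X : Type*} (ρ : X → S) {U : Set X} {l : Filter X} (hl : ∀ᶠ c in l, c ∈ U)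
    (e : ∀ c : X, D.V.fiber (ρ c) ≃ₗ[ℚ] V) (H₀ : HodgeStructure V k) (P₀ : H₀.Polarization) (g : X → Module.End ℂ (ℂ ⊗[ℚ] V))
    (hg1 : ∀ (w : ℂ ⊗[ℚ] V) (φ : (ℂ ⊗[ℚ] V) →ₗ[ℂ] ℂ), Tendsto (fun c => φ (g c w)) l (𝓝 (φ w)))
    (hF : ∀ c ∈ U, ∀ q : ℤ, ((D.hodge (ρ c)).F q).map ((e c).toLinearMap.baseChange ℂ) = (H₀.F q).map (g c))
    (hQ : ∀ c ∈ U, ∀ x y : D.V.fiber (ρ c), (D.form (ρ c)).form x y = P₀.form (e c x) (e c y)) {ε : ℝ} (hε : 0 < ε) :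
    ∀ᶠ c in l, c ∈ U ∧ ∀ x : D.V.fiber (ρ c),
      (1 - ε) * P₀.hodgeNorm (ofRat (e c x)) ≤ (D.form (ρ c)).hodgeNorm (ofRat x) ∧
        (D.form (ρ c)).hodgeNorm (ofRat x) ≤ (1 + ε) * P₀.hodgeNorm (ofRat (e c x)) := by
  have hHR : ∀ᶠ c in l, ∀ p : ℤ, ∀ x ∈ H₀.F p, ∀ y ∈ H₀.F (k + 1 - p), P₀.form.baseChange ℂ (g c x) (g c y) = 0 := by
    filter_upwards [hl] with c hc p x hx y hy
    exact D.form_baseChange_lift_apply_eq_zero (e c) H₀ P₀ (g c) (hF c hc) (hQ c hc) p x hx y hy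
  filter_upwards [hl, P₀.eventually_exists_hodgeNorm_mem_Icc g hg1 hHR hε] with c hc ⟨H', P', hF', hform', hb⟩
  refine ⟨hc, fun x => ?_⟩
  have hflag : ∀ q, ((D.hodge (ρ c)).comapEquiv (e c).symm).F q = (H₀.F q).map (g c) := D.comapEquiv_symm_F_eq_of_map_F_eq (e c) (hF c hc)
  have hform : ((D.form (ρ c)).comapEquiv (e c).symm).form = P₀.form := D.comapEquiv_symm_form_eq_of_form_eq (e c) (hQ c hc)
  have heq : (D.form (ρ c)).hodgeNorm (ofRat x) = P'.hodgeNorm (ofRat (e c x)) := by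
    rw [← D.hodgeNorm_comapEquiv_symm_ofRat_equiv (e c) x]
    exact Polarization.hodgeNorm_congr _ P' (fun q => by rw [hflag, hF']) (by rw [hform, hform']) _
  rw [heq]
  exact hb _

/-! ## §2 The local alternative at a point, for a holomorphic-lift chart modelled on `E` -/

variable {E : Type*} [NormedAddCommGroup E] [NormedSpace ℂ E]

/-- **At `x`, for a holomorphic-lift chart modelled on a complex normed space `E`: a neighbourhood of `x` inside `hodgeLocusOfNormLe D p K`, or a
neighbourhood on which the locus has empty interior** — the hypothesis of `Literature.Topology.eq_univ_or_interior_eq_empty`, WITHOUT a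
comparison hypothesis (on a coordinate ball around `ψ(x)` the Hodge metrics are uniformly comparable with `κ = 1/2`, §1).
[cite: CattaniDeligneKaplan1995, §1 (pp. 483–484)] [cite: CattaniKaplanSchmid1987, §3 proof of Cor. (3.7) (p. 22)] [cite: VoisinHodgeII2003, §5.3.1 Lemma 5.13] -/
theorem exists_mem_nhds_subset_or_interior_eq_empty_of_lift {p : ℤ} (hpk : p + p = k) (ψ : OpenPartialHomeomorph S E) {x : S}
    (hx : x ∈ ψ.source) (e : ∀ c : E, D.V.fiber (ψ.symm c) ≃ₗ[ℚ] V) (H₀ : HodgeStructure V k) (P₀ : H₀.Polarization)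
    (g h : E → Module.End ℂ (ℂ ⊗[ℚ] V)) (hgh : ∀ c ∈ ψ.target, ∀ w, g c (h c w) = w) (hhg : ∀ c ∈ ψ.target, ∀ w, h c (g c w) = w)
    (hh : ∀ (φ : Module.Dual ℂ (ℂ ⊗[ℚ] V)) (w : ℂ ⊗[ℚ] V), AnalyticOnNhd ℂ (fun c => φ (h c w)) ψ.target)
    (hg1 : ∀ (w : ℂ ⊗[ℚ] V) (φ : (ℂ ⊗[ℚ] V) →ₗ[ℂ] ℂ), Tendsto (fun c => φ (g c w)) (𝓝 (ψ x)) (𝓝 (φ w)))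
    (hF : ∀ c ∈ ψ.target, ∀ q : ℤ, ((D.hodge (ψ.symm c)).F q).map ((e c).toLinearMap.baseChange ℂ) = (H₀.F q).map (g c))
    (hQ : ∀ c ∈ ψ.target, ∀ x y : D.V.fiber (ψ.symm c), (D.form (ψ.symm c)).form x y = P₀.form (e c x) (e c y))
    (Λ : Submodule ℤ V) (hΛ : Λ.FG) (hΛ₁ : ∀ c ∈ ψ.target, ∀ u : D.VZ.fiber (ψ.symm c), e c (D.toRat (ψ.symm c) u) ∈ Λ)
    (hΛ₂ : ∀ c ∈ ψ.target, ∀ v ∈ Λ, ∃ u : D.VZ.fiber (ψ.symm c), e c (D.toRat (ψ.symm c) u) = v) (K : ℤ) :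
    (∃ W ∈ 𝓝 x, W ⊆ D.hodgeLocusOfNormLe p K ∨ interior (D.hodgeLocusOfNormLe p K ∩ W) = ∅) ∧
      (x ∉ D.hodgeLocusOfNormLe p K → (D.hodgeLocusOfNormLe p K)ᶜ ∈ 𝓝 x) := by
  have hc₀ : ψ x ∈ ψ.target := ψ.map_source hx
  -- a coordinate ball around `ψ x` inside the target with comparable Hodge metrics (`κ = 1/2`)
  have hev := D.eventually_hodgeNorm_fiber_mem_Icc_of_lift_filter ψ.symm (l := 𝓝 (ψ x)) (ψ.open_target.mem_nhds hc₀) e H₀ P₀ g hg1 hF hQ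
    (ε := 1 / 2) (by norm_num)
  obtain ⟨r, hr, hball⟩ := Metric.mem_nhds_iff.1 hev
  set B : Set E := Metric.ball (ψ x) r with hB
  have hBU : ∀ c ∈ B, c ∈ ψ.target := fun c hc => (hball hc).1
  have hnorm : ∀ c ∈ B, ∀ y : D.V.fiber (ψ.symm c), 1 / 2 * P₀.hodgeNorm (ofRat (e c y)) ≤ (D.form (ψ.symm c)).hodgeNorm (ofRat y) :=
    fun c hc y => by
      have h1 := ((hball hc).2 y).1
      norm_num at h1 ⊢
      linarith
  have hhB : ∀ (φ : Module.Dual ℂ (ℂ ⊗[ℚ] V)) (w : ℂ ⊗[ℚ] V), AnalyticOnNhd ℂ (fun c => φ (h c w)) B :=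
    fun φ w => (hh φ w).mono fun c hc => hBU c hc
  have hFB : ∀ c ∈ B, ((D.hodge (ψ.symm c)).F p).map ((e c).toLinearMap.baseChange ℂ) = (H₀.F p).comap (h c) := fun c hc => by
    rw [hF c (hBU c hc) p, comap_eq_map_of_inverse' (H₀.F p) (hgh c (hBU c hc)) (hhg c (hBU c hc))]
  -- the open neighbourhood `W = source ∩ ψ⁻¹ B` of `x`
  set W : Set S := ψ.source ∩ ψ ⁻¹' B with hW
  have hWo : IsOpen W := ψ.isOpen_inter_preimage Metric.isOpen_ball
  have hxW : x ∈ W := ⟨hx, Metric.mem_ball_self hr⟩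
  refine ⟨⟨W, hWo.mem_nhds hxW, ?_⟩, fun hnot => ?_⟩
  · rcases D.forall_mem_hodgeLocusOfNormLe_or_interior_eq_empty_chart hpk ψ.symm (convex_ball (ψ x) r).isPreconnected e H₀ P₀ h hhB hFB
      (fun c hc => hQ c (hBU c hc)) Λ hΛ (fun c hc => hΛ₁ c (hBU c hc)) (fun c hc => hΛ₂ c (hBU c hc)) (κ := 1 / 2) (by norm_num) hnorm K
      with hall | hint
    · refine Or.inl ?_
      rintro y ⟨hy, hyB⟩
      have h1 := hall (ψ y) hyB
      rwa [ψ.left_inv hy] at h1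
    · refine Or.inr (eq_empty_of_forall_notMem fun y hy => ?_)
      set O : Set S := interior (D.hodgeLocusOfNormLe p K ∩ W) with hO
      have hOsrc : O ⊆ ψ.source := interior_subset.trans (inter_subset_right.trans inter_subset_left)
      have hOopen : IsOpen (ψ '' O) := (ψ.isOpen_image_iff_of_subset_source hOsrc).2 isOpen_interior
      have hOsub : ψ '' O ⊆ {c : E | c ∈ B ∧ ψ.symm c ∈ D.hodgeLocusOfNormLe p K} := by
        rintro _ ⟨z, hz, rfl⟩
        refine ⟨(interior_subset hz).2.2, ?_⟩
        rw [ψ.left_inv (hOsrc hz)]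
        exact (interior_subset hz).1
      have hmem : ψ y ∈ interior {c : E | c ∈ B ∧ ψ.symm c ∈ D.hodgeLocusOfNormLe p K} := interior_maximal hOsub hOopen ⟨y, hy, rfl⟩
      rw [hint] at hmem
      exact hmem
  · have hnot' : ψ.symm (ψ x) ∉ D.hodgeLocusOfNormLe p K := by rwa [ψ.left_inv hx]
    have hev' := D.eventually_not_mem_hodgeLocusOfNormLe_chart hpk ψ.symm e H₀ P₀ h hhB hFB (fun c hc => hQ c (hBU c hc)) Λ hΛ
      (fun c hc => hΛ₁ c (hBU c hc)) (fun c hc => hΛ₂ c (hBU c hc)) (κ := 1 / 2) (by norm_num) hnorm K (Metric.mem_ball_self hr) hnot'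
    have h1 : ∀ᶠ y in 𝓝 x, y ∈ W := hWo.mem_nhds hxW
    filter_upwards [h1, (ψ.continuousAt hx).eventually hev'] with y hy hPy
    have h3 := hPy hy.2
    rwa [ψ.left_inv hy.1] at h3

/-! ## §3 Everything or nowhere dense, holomorphic-lift charts -/

/-- **THE HODGE LOCUS OF BOUNDED NORM OVER A CONNECTED BASE OF ANY DIMENSION IS CLOSED AND EITHER EVERYTHING OR NOWHERE DENSE — holomorphic-lift
charts.**  `D : VHSData S k` (`k = p + p`), `S` preconnected; at every point `x`: `ψ : OpenPartialHomeomorph S E` with `x ∈ ψ.source`, a flat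
trivialization `e c : V_{ψ⁻¹(c)} ≃ V` carrying every `F^q` to `g(c)·F₀^q` (`g`, `h = g⁻¹`, `h` weakly holomorphic on the target, `g(c) → 1` weakly
at `ψ(x)`), `Q` to `Q₀` and `V_ℤ` ONTO a finitely generated `Λ₀`.  Then **`hodgeLocusOfNormLe D p K` is closed, and is `S` or nowhere dense**
(«locally on `S`, `S^{(K)}` is a finite disjoint sum of closed analytic subspaces»).
[cite: CattaniDeligneKaplan1995, §1 (pp. 483–484)] [cite: CattaniKaplanSchmid1987, §3 proof of Cor. (3.7) (p. 22)] [cite: VoisinHodgeII2003, §5.3.1 Lemma 5.13] -/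
theorem hodgeLocusOfNormLe_eq_univ_or_isNowhereDense_of_lift [PreconnectedSpace S] {p : ℤ} (hpk : p + p = k) (K : ℤ)
    (hint : ∀ x : S, ∃ ψ : OpenPartialHomeomorph S E, x ∈ ψ.source ∧
      ∃ (e : ∀ c : E, D.V.fiber (ψ.symm c) ≃ₗ[ℚ] V) (H₀ : HodgeStructure V k) (P₀ : H₀.Polarization) (g h : E → Module.End ℂ (ℂ ⊗[ℚ] V))
        (Λ₀ : Submodule ℤ V),
        (∀ c ∈ ψ.target, ∀ w, g c (h c w) = w) ∧ (∀ c ∈ ψ.target, ∀ w, h c (g c w) = w) ∧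
        (∀ (φ : Module.Dual ℂ (ℂ ⊗[ℚ] V)) (w : ℂ ⊗[ℚ] V), AnalyticOnNhd ℂ (fun c => φ (h c w)) ψ.target) ∧
        (∀ (w : ℂ ⊗[ℚ] V) (φ : (ℂ ⊗[ℚ] V) →ₗ[ℂ] ℂ), Tendsto (fun c => φ (g c w)) (𝓝 (ψ x)) (𝓝 (φ w))) ∧
        (∀ c ∈ ψ.target, ∀ q : ℤ, ((D.hodge (ψ.symm c)).F q).map ((e c).toLinearMap.baseChange ℂ) = (H₀.F q).map (g c)) ∧
        (∀ c ∈ ψ.target, ∀ x y : D.V.fiber (ψ.symm c), (D.form (ψ.symm c)).form x y = P₀.form (e c x) (e c y)) ∧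
        Λ₀.FG ∧ (∀ c ∈ ψ.target, ∀ u : D.VZ.fiber (ψ.symm c), e c (D.toRat (ψ.symm c) u) ∈ Λ₀) ∧
        (∀ c ∈ ψ.target, ∀ v ∈ Λ₀, ∃ u : D.VZ.fiber (ψ.symm c), e c (D.toRat (ψ.symm c) u) = v)) :
    IsClosed (D.hodgeLocusOfNormLe p K) ∧ (D.hodgeLocusOfNormLe p K = univ ∨ IsNowhereDense (D.hodgeLocusOfNormLe p K)) := by
  have hloc : ∀ x : S, (∃ W ∈ 𝓝 x, W ⊆ D.hodgeLocusOfNormLe p K ∨ interior (D.hodgeLocusOfNormLe p K ∩ W) = ∅) ∧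
      (x ∉ D.hodgeLocusOfNormLe p K → (D.hodgeLocusOfNormLe p K)ᶜ ∈ 𝓝 x) := fun x => by
    obtain ⟨ψ, hx, e, H₀, P₀, g, h, Λ₀, hgh, hhg, hh, hg1, hF, hQ, hΛ₀, hΛ₁, hΛ₂⟩ := hint x
    exact D.exists_mem_nhds_subset_or_interior_eq_empty_of_lift hpk ψ hx e H₀ P₀ g h hgh hhg hh hg1 hF hQ Λ₀ hΛ₀ hΛ₁ hΛ₂ K
  have hclosed : IsClosed (D.hodgeLocusOfNormLe p K) := by
    rw [← isOpen_compl_iff, isOpen_iff_mem_nhds]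
    exact fun x hx => (hloc x).2 hx
  exact ⟨hclosed, Literature.Topology.eq_univ_or_isNowhereDense hclosed fun x => (hloc x).1⟩

end Motives.VHSData

end Literature.AlgebraicGeometry

end
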